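import Summits.ABC.ABC.Theorems.DefiniteXiPeterssonLowerBound
import Summits.ABC.ABC.Theses.IsogenyGlueCongruence
import HarnessLib

/-!
# Skeleton (line `Sketch`, lead c7 re-own, 2026-08-16T17:00Z; unchanged from c5/c6) for the crux `DefiniteXi.PeterssonLowerBound` (stmt-ABC-10870)

Lead c5 change: the accepted composition module `Summits.ABC.ABC.Theorems.DefiniteXiPeterssonLowerBound`
(p107692) now BUILDS on the farm, so this skeleton IMPORTS it instead of carrying leads c1–c4's inline copy
(290 lines → 3 declarations; same registered stub list `[stub_fact_symmFour]`, same two closing theorems by name).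

Everything provable is LANDED: the composition
`Summit.ABC.ABC.Theorems.PeterssonLowerBound_of :
  Literature.NumberTheory.Automorphic.Kim2003_symmFourL_nonCM_entire_polyBound →
  Summit.ABC.ABC.Theses.DefiniteXi.PeterssonLowerBound`
(`Theorems/DefiniteXiPeterssonLowerBound.lean`, p107692; stubs p98483 p103615 p103973 p105349). The ONE open
stub is the fact-stub `stub_fact_symmFour` = the Literature named fact (Kim 2003 Thm B + Kim–Shahidi 2002 +
Godement–Jacquet + convexity), crux-sized. This file imports the accepted composition instead of inlining it.
-/

noncomputable section

set_option linter.dupNamespace false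

namespace Summit.ABC.ABC.Theorems

/-- **Fact-stub: the analytic package of `L(s, Sym⁴ E)` for non-CM `E/ℚ`** (Kim 2003, Thm. B;
Kim–Shahidi 2002; Godement–Jacquet; convexity) — the Literature named fact
`Literature.NumberTheory.Automorphic.Kim2003_symmFourL_nonCM_entire_polyBound`, closed the day
`…_holds` lands. NOT a worker stub. [cite: Kim2003, Thm. B] [cite: KimShahidi2002, Thm. 3.3.7] -/
theorem stub_fact_symmFour : Literature.NumberTheory.Automorphic.Kim2003_symmFourL_nonCM_entire_polyBound := by
  sorry

/-- **The crux by name** (route `DefiniteXi`), closed modulo the fact-stub by the landed composition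
`PeterssonLowerBound_of`. [cite: HoffsteinLockhart1994, Thm. 0.1] -/
theorem PeterssonLowerBound_proof : Summit.ABC.ABC.Theses.DefiniteXi.PeterssonLowerBound :=
  PeterssonLowerBound_of stub_fact_symmFour

/-- **The shared decl of route `IsogenyGlueCongruence`** (the same term), closed by the same composition
modulo the fact-stub. [cite: HoffsteinLockhart1994, Thm. 0.1] -/
theorem IsogenyGlueCongruence_PeterssonLowerBound_proof :
    Summit.ABC.ABC.Theses.IsogenyGlueCongruence.PeterssonLowerBound :=
  PeterssonLowerBound_of stub_fact_symmFour

end Summit.ABC.ABC.Theorems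

end
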